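import Mathlib
import Literature.RingTheory.MvPolynomial.GrobnerDegeneration
import Literature.RingTheory.MvPolynomial.WeightMonomialOrder
import Literature.RingTheory.MvPolynomial.LeadingExponents
import Summits.ResolutionOfSingularities.ResolutionOfSingularities.Theorems.TropicalLinksSchonResolvesStandardIndependent
import Summits.ResolutionOfSingularities.ResolutionOfSingularities.Theorems.TropicalLinksSchonResolvesMonomialSubStandard

/-!
# TropicalLinks / SchonResolves — the Gröbner degeneration inside a Gröbner cone is FREE over `k[t]`
# with basis the standard monomials (Eisenbud 15.17 / Tevelev 1.7, assembled)

Route `ResolutionOfSingularities/TropicalLinks`, crux `SchonResolves` (stmt-ResolutionOfSingularities-17234),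
line `zariski-toric-closure`, brick F1 = KERNEL (P1): for an ideal `I ⊆ k[x_σ]` over a field, natural
weight vectors `W i` (`i : ι` finite) and a monomial order `m` such that every ray weight order
`≺_{W i, m}` has the same leading exponents as `m` on `I` (the cone spanned by the `W i` lies in the
closed Gröbner cone of `m`), the total space `k[t_ι][x_σ] ⧸ grobnerDegeneration W I` of the Gröbner
degeneration (`Literature.RingTheory.MvPolynomial.grobnerDegeneration`, p170288) is a FREE
`k[t_ι]`-module, with basis the classes of the standard monomials `x^a`, `a ∉ E_m(I)`
(`schonResolves_grobnerDegeneration_basis`); hence flat (`schonResolves_grobnerDegeneration_flat`).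
Spanning: `schonResolves_grobnerDegeneration_monomial_sub_standard_mem` (p171787); independence:
`schonResolves_grobnerDegeneration_standard_independent` (p171763). This is the flatness of
"Gröbner degenerations are flat families" (Eisenbud, *Commutative Algebra*, Thm 15.17, one weight;
Tevelev 2007, Thm 1.7 / Maclagan–Sturmfels §2.4–2.5 for cones of the Gröbner fan), the input of the
regularity of tropical compactifications of schön varieties (stub `stub_chartRegular` of the line).

References: [Eisenbud1995] Thm 15.17; [Tevelev2007] Thm 1.7; [MaclaganSturmfels2015] §2.4–2.5.
-/

-- single-problem summit: the doubled namespace component `ResolutionOfSingularities` is forced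
set_option linter.dupNamespace false

namespace Summit.ResolutionOfSingularities.ResolutionOfSingularities.Theorems

open MvPolynomial Literature.RingTheory.MvPolynomial

/-- **The standard monomials form a `k[t]`-basis of the Gröbner degeneration inside a Gröbner cone**
(registered brick F1 / KERNEL (P1)). Hypothesis: for every `i`, the weight order `≺_{W i, m}` has the
same leading-exponent set on `I` as `m`. Conclusion: the classes of `x^a`, `a ∉ E_m(I)`, form a basis of
`k[t_ι][x_σ] ⧸ grobnerDegeneration W I` over `k[t_ι] = MvPolynomial ι k`.
[cite: Eisenbud1995, Thm. 15.17]; [cite: Tevelev2007, Thm. 1.7] -/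
theorem schonResolves_grobnerDegeneration_basis :
    ∀ (k : Type) [Field k] (σ ι : Type) [Fintype ι] [DecidableEq ι] (W : ι → σ → ℕ) (m : MonomialOrder σ) (I : Ideal (MvPolynomial σ k)), (∀ i : ι, Literature.RingTheory.MvPolynomial.leadingExponents (Literature.RingTheory.MvPolynomial.weightLex (W i) m) I = Literature.RingTheory.MvPolynomial.leadingExponents m I) → ∃ b : Module.Basis {a : σ →₀ ℕ // a ∉ Literature.RingTheory.MvPolynomial.leadingExponents m I} (MvPolynomial ι k) (MvPolynomial σ (MvPolynomial ι k) ⧸ Literature.RingTheory.MvPolynomial.grobnerDegeneration W I), ∀ a, b a = Ideal.Quotient.mk (Literature.RingTheory.MvPolynomial.grobnerDegeneration W I) (MvPolynomial.monomial a.1 1) := by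
  intro k _ σ ι _ _ W m I hcone
  classical
  -- the scalar action of `k[t]` on the quotient is multiplication by `C r`
  have hsmul : ∀ (r : MvPolynomial ι k) (f : MvPolynomial σ (MvPolynomial ι k)),
      r • Ideal.Quotient.mk (grobnerDegeneration W I) f =
        Ideal.Quotient.mk (grobnerDegeneration W I) (C r * f) := by
    intro r f
    rw [← smul_eq_C_mul]
    rfl
  -- linear independence over `k[t]`
  have hli : LinearIndependent (MvPolynomial ι k)
      (fun a : {a : σ →₀ ℕ // a ∉ leadingExponents m I} =>
        Ideal.Quotient.mk (grobnerDegeneration W I) (monomial a.1 (1 : MvPolynomial ι k))) := by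
    rw [linearIndependent_iff]
    intro l hl
    have hinj : Function.Injective
        (Subtype.val : {a : σ →₀ ℕ // a ∉ leadingExponents m I} → (σ →₀ ℕ)) :=
      Subtype.val_injective
    have hcsupp : ∀ b ∈ (l.mapDomain Subtype.val).support, b ∉ leadingExponents m I := by
      intro b hb
      rw [Finsupp.mapDomain_support_of_injective hinj] at hb
      obtain ⟨a, -, rfl⟩ := Finset.mem_image.1 hb
      exact a.2
    have hsum : (∑ b ∈ (l.mapDomain Subtype.val).support, monomial b (l.mapDomain Subtype.val b)) =
        ∑ a ∈ l.support, monomial a.1 (l a) := by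
      rw [Finsupp.mapDomain_support_of_injective hinj, Finset.sum_image (fun x _ y _ h => hinj h)]
      refine Finset.sum_congr rfl fun a _ => ?_
      rw [Finsupp.mapDomain_apply hinj]
    have hmem : (∑ b ∈ (l.mapDomain Subtype.val).support, monomial b (l.mapDomain Subtype.val b)) ∈
        grobnerDegeneration W I := by
      rw [hsum, ← Ideal.Quotient.eq_zero_iff_mem, map_sum]
      rw [Finsupp.linearCombination_apply, Finsupp.sum] at hl
      rw [← hl]
      refine Finset.sum_congr rfl fun a _ => ?_
      rw [hsmul, C_mul_monomial, mul_one]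
    have hc0 := schonResolves_grobnerDegeneration_standard_independent k σ ι W m I _ hcsupp hmem
    exact Finsupp.mapDomain_injective hinj (by rw [hc0, Finsupp.mapDomain_zero])
  -- spanning: every monomial class is a `k[t]`-combination of standard monomial classes
  have hspan_mono : ∀ a : σ →₀ ℕ, Ideal.Quotient.mk (grobnerDegeneration W I) (monomial a 1) ∈
      Submodule.span (MvPolynomial ι k) (Set.range fun a : {a : σ →₀ ℕ // a ∉ leadingExponents m I} =>
        Ideal.Quotient.mk (grobnerDegeneration W I) (monomial a.1 (1 : MvPolynomial ι k))) := by
    intro a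
    by_cases ha : a ∈ leadingExponents m I
    · obtain ⟨r, hr, hmem⟩ :=
        schonResolves_grobnerDegeneration_monomial_sub_standard_mem k σ ι W m I hcone a ha
      have heq : Ideal.Quotient.mk (grobnerDegeneration W I) (monomial a 1) =
          Ideal.Quotient.mk (grobnerDegeneration W I) r := by
        rw [Ideal.Quotient.eq]
        exact hmem
      rw [heq, r.as_sum, map_sum]
      refine Submodule.sum_mem _ fun b hb => ?_
      have hb' : b ∉ leadingExponents m I := hr b hb
      rw [← mul_one (coeff b r), ← C_mul_monomial, ← hsmul]
      exact Submodule.smul_mem _ _ (Submodule.subset_span ⟨⟨b, hb'⟩, rfl⟩)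
    · exact Submodule.subset_span ⟨⟨a, ha⟩, rfl⟩
  have hsp : ⊤ ≤ Submodule.span (MvPolynomial ι k) (Set.range fun a : {a : σ →₀ ℕ // a ∉ leadingExponents m I} =>
      Ideal.Quotient.mk (grobnerDegeneration W I) (monomial a.1 (1 : MvPolynomial ι k))) := by
    rintro q -
    obtain ⟨f, rfl⟩ := Ideal.Quotient.mk_surjective q
    rw [f.as_sum, map_sum]
    refine Submodule.sum_mem _ fun a _ => ?_
    rw [← mul_one (coeff a f), ← C_mul_monomial, ← hsmul]
    exact Submodule.smul_mem _ _ (hspan_mono a)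
  exact ⟨Module.Basis.mk hli hsp, fun a => Module.Basis.mk_apply hli hsp a⟩

/-- **Gröbner degenerations inside a Gröbner cone are flat** (free) over `k[t]`: corollary of the
basis theorem. [cite: Eisenbud1995, Thm. 15.17] -/
theorem schonResolves_grobnerDegeneration_flat :
    ∀ (k : Type) [Field k] (σ ι : Type) [Fintype ι] [DecidableEq ι] (W : ι → σ → ℕ) (m : MonomialOrder σ) (I : Ideal (MvPolynomial σ k)), (∀ i : ι, Literature.RingTheory.MvPolynomial.leadingExponents (Literature.RingTheory.MvPolynomial.weightLex (W i) m) I = Literature.RingTheory.MvPolynomial.leadingExponents m I) → Module.Free (MvPolynomial ι k) (MvPolynomial σ (MvPolynomial ι k) ⧸ Literature.RingTheory.MvPolynomial.grobnerDegeneration W I) ∧ Module.Flat (MvPolynomial ι k) (MvPolynomial σ (MvPolynomial ι k) ⧸ Literature.RingTheory.MvPolynomial.grobnerDegeneration W I) := by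
  intro k _ σ ι _ _ W m I hcone
  obtain ⟨b, -⟩ := schonResolves_grobnerDegeneration_basis k σ ι W m I hcone
  haveI : Module.Free (MvPolynomial ι k)
      (MvPolynomial σ (MvPolynomial ι k) ⧸ Literature.RingTheory.MvPolynomial.grobnerDegeneration W I) :=
    Module.Free.of_basis b
  exact ⟨inferInstance, inferInstance⟩

end Summit.ResolutionOfSingularities.ResolutionOfSingularities.Theorems
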